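import Summits.FinalStateConjecture.FinalStateConjecture.Theorems.SwallowTheDatumParametricKerrBurialStubLocatedPlugAux1
import Summits.FinalStateConjecture.FinalStateConjecture.Theorems.SwallowTheDatumKerrShieldedDataExistOfPlugData
import Summits.FinalStateConjecture.FinalStateConjecture.Theorems.SwallowTheDatumParametricKerrBurialLine
import HarnessLib

/-!
# `ParametricKerrBurial`, line `receding-annulus-universal-collar` — stub `stub_locatedPlug` (S5a)

Stub S5a of the lead's skeleton for crux `stmt-FinalStateConjecture-10052`
(`Summit.FinalStateConjecture.FinalStateConjecture.Theses.SwallowTheDatum.ParametricKerrBurial`): from PlugData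
(a mass `M > 0`, a depth `0 < ρ₃ < M/40` and a smooth vacuum datum `D₀` on `E3` which is EXACTLY time-symmetric
isotropic Schwarzschild `((1 + M/2ρ)⁴ δ, 0)` on `{ρ > ρ₃}`) an ADMISSIBLE vacuum datum `D` on `E3` which
IS `D₀` on the core ball `{‖y‖ < M/32}` and is Kerr-shielded by a chart ranging in `{‖y‖ > M}`
(`IsKerrShieldedAway M D`).

This is the sibling crux 10055's landed assembly (`stub_assembly`, `kerrShieldedDataExist_of_plugData`) RE-RUN
with two extra exports that hold by construction but are not recorded by the landed statements:

* `LocatedPlug.assembly_located` — copy of `stub_assembly` (plug | bridge | Kerr–Schild zone | bent leaf pushed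
  forward along the radial profile of `…AssemblyProfile`, glued by `LocatedPlug.exists_zonesData_core`) whose
  conclusion records the agreement with `D₀` on the core ball and packages the shielding block as
  `IsKerrShieldedAway r₁ D`: the end chart `φ` is a self-map of the slice `{‖y‖ > r₁}` followed by the
  inclusion, so it ranges in `{‖y‖ > r₁}`;
* `stub_locatedPlug` — the registered statement: slice clause at the junction radius `r₁ := M`
  (`stub_sliceClause`) → bridge (`stub_bridgeAnnulus`, fed with `stub_ricciFlatKS` and `stub_inducedVacuumData`) →
  `assembly_located` → the sole Dafermos–Rodnianski end of the exactly isotropic far region (`stub_isotropicEnd`)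
  → completeness (`isComplete_of_isSoleEnd_holds`) → `admissibleVacuumData`.

References: R. Bartnik, J. Isenberg, *The constraint equations* (2004), §2; G. B. Cook, Living Rev. Relativ. 3
(2000) 5, §3.2.2; R. M. Wald, *General Relativity* (1984), §6.4; J. Li, H. Mei, arXiv:2005.01249, §2.2.
-/

-- the doubled `FinalStateConjecture` path component is the summit/problem naming scheme, not a mistake
set_option linter.dupNamespace false

noncomputable section

namespace Summit.FinalStateConjecture.FinalStateConjecture.Theorems.SwallowTheDatum.ParametricKerrBurial

open scoped Manifold ContDiff Topology BigOperators InnerProductSpace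
open Bundle Set Filter Function MeasureTheory Literature.Geometry.Lorentzian
open Literature.Geometry.Lorentzian.InitialDataSet
open Literature.Geometry.Manifold (OpenSubmanifold.mfderiv_subtype_val OpenSubmanifold.mdifferentiableAt_subtype_val)
open Summit.FinalStateConjecture.FinalStateConjecture.Theorems.KerrShieldedDataExist (Negative.graph
  Negative.bentHeight Negative.rPlus_add_rMinus)
open Assembly (mem_slice_zero_of_lt lt_norm_of_mem_slice_zero exists_radialProfile exists_ksZoneData
  exists_leafZoneData)

namespace LocatedPlug

variable {M ρ₃ r₁ : ℝ}

/-- **The located assembly** (copy of `stub_assembly` of crux 10055 with two extra exports). Plug + bridge +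
Kerr–Schild zone + leaf zone glued on `E3` (`LocatedPlug.exists_zonesData_core`): a vacuum datum `D` on `E3`, exactly
`((1 + M/2ρ)⁴δ, 0)` beyond `7M`, EQUAL TO `D₀` on the core ball `{‖y‖ < M/32}`, and Kerr-shielded AWAY from the
closed ball of radius `r₁` (`a = 0`, `T = bentHeight M 0`, `ψ = Negative.graph M 0 r₁`, `ν = N₀`, end chart
`φ = (S(|y|)/|y|) y` — a self-map of the slice `{‖y‖ > r₁}` followed by the inclusion, hence located; compact
complement `= closedBall r₁`, open embedding, smooth; pull-back identities by construction of the leaf zone).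
[cite: BartnikIsenberg2004, §2] [cite: Cook2000, §3.2.2] [cite: Wald1984, §6.4] -/
theorem assembly_located [Kerr.Facts] (hM : 0 ≤ M) (hM0 : 0 < M) (hρ₃M : ρ₃ < M / 40)
    (D₀ : InitialDataSet (𝓡 3) E3) (hvac₀ : ∀ [D₀.metric.HasLeviCivita], D₀.IsVacuumConstraintSolution)
    (hexact₀ : ∀ y : E3, ρ₃ < ‖y‖ →
      (∀ v w : E3, D₀.h.inner y v w = Schwarzschild.conformalFactor M y ^ 4 * ⟪v, w⟫_ℝ) ∧ D₀.k y = 0)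
    (hRic : ∀ (r₀ : ℝ) [(Kerr.smoothMetric M 0 r₀).HasLeviCivita] (x : Kerr.region 0 r₀),
      (Kerr.smoothMetric M 0 r₀).ricci x = 0)
    (hInd : ∀ (r₀ : ℝ) (U : TopologicalSpace.Opens E3) (Φ N : E3 → E4)
      (f : U → Kerr.region 0 r₀) (ν : NormalField 𝓘(ℝ, E4) f),
      (∀ [(Kerr.smoothMetric M 0 r₀).HasLeviCivita] (x : Kerr.region 0 r₀), (Kerr.smoothMetric M 0 r₀).ricci x = 0) →
      (∀ y : U, ((f y : Kerr.region 0 r₀) : E4) = Φ y) → (∀ y : U, ν y = N y) →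
      ContDiffOn ℝ ∞ Φ (U : Set E3) → ContDiffOn ℝ ∞ N (U : Set E3) →
      (Kerr.smoothMetric M 0 r₀).IsSpacelikeImmersion 𝓘(ℝ, E3) f →
      (Kerr.smoothMetric M 0 r₀).IsUnitNormal 𝓘(ℝ, E3) f ν (-1) →
      ∃ D : InitialDataSet 𝓘(ℝ, E3) U,
        (∀ y : U, D.h.inner y = (Kerr.smoothMetric M 0 r₀).inducedBilin 𝓘(ℝ, E3) f y) ∧
        (∀ [(Kerr.smoothMetric M 0 r₀).HasLeviCivita] (y : U),
          (D.k y).toLinearMap₁₂ = (Kerr.smoothMetric M 0 r₀).secondFundamentalForm 𝓘(ℝ, E3) f ν y) ∧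
        (∀ [D.metric.HasLeviCivita], D.IsVacuumConstraintSolution))
    (hBridge : ∀ (Ω : TopologicalSpace.Opens E3), (Ω : Set E3) = {y : E3 | M / 40 < ‖y‖ ∧ ‖y‖ < 3 * M / 4} →
      ∃ Db : InitialDataSet 𝓘(ℝ, E3) Ω,
        (∀ [Db.metric.HasLeviCivita], Db.IsVacuumConstraintSolution) ∧
        (∀ y : Ω, ‖(y : E3)‖ < M / 30 →
          (∀ v w : E3, Db.h.inner y v w = Schwarzschild.conformalFactor M (y : E3) ^ 4 * ⟪v, w⟫_ℝ) ∧
            Db.k y = 0) ∧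
        (∀ y : Ω, 7 * M / 10 < ‖(y : E3)‖ →
          (∀ v w : E3, Db.h.inner y v w = Kerr.hRep M (y : E3) v w) ∧
            (∀ v w : E3, Db.k y v w = Kerr.kRep M (y : E3) v w)))
    (hr₁a : 3 * M / 4 < r₁) (hr₁b : r₁ < 2 * M)
    (hsp : (Kerr.smoothMetric M 0 r₁).IsSpacelikeImmersion 𝓘(ℝ, E3) (Negative.graph M 0 r₁))
    (N₀ : E3 → E4) (hN₀ : ContDiffOn ℝ ∞ N₀ (Kerr.slice 0 r₁ : Set E3))
    (hν : (Kerr.smoothMetric M 0 r₁).IsFutureUnitNormal 𝓘(ℝ, E3) ((Kerr.timeOrientation M 0 r₁ hM).ofLE le_top)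
      (Negative.graph M 0 r₁) (fun y ↦ N₀ y)) :
    ∃ D : InitialDataSet (𝓡 3) E3,
      (∀ [D.metric.HasLeviCivita], D.IsVacuumConstraintSolution) ∧
      (∃ R : ℝ, 0 < R ∧ ∀ y : E3, R < ‖y‖ →
        (∀ v w : E3, D.h.inner y v w = Schwarzschild.conformalFactor M y ^ 4 * ⟪v, w⟫_ℝ) ∧ D.k y = 0) ∧
      (∀ y : E3, ‖y‖ < M / 32 → D.h.inner y = D₀.h.inner y ∧ D.k y = D₀.k y) ∧
      IsKerrShieldedAway r₁ D := by
  have hr₁ : 0 < r₁ := by linarith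
  have hr₁4 : r₁ < 4 * M := by linarith
  have h0 : |(0 : ℝ)| < M := by rwa [abs_zero]
  -- the radial profile of the end chart
  obtain ⟨Q, S, hQs, hSs, hQm, hSm, hSQ, hQS, hQid, hSid, hQfar, -⟩ := exists_radialProfile hM0
  -- the bridge datum
  have hΩo : IsOpen {y : E3 | M / 40 < ‖y‖ ∧ ‖y‖ < 3 * M / 4} :=
    (isOpen_lt continuous_const continuous_norm).inter (isOpen_lt continuous_norm continuous_const)
  obtain ⟨Db, hDbvac, hDbin, hDbout⟩ := hBridge ⟨{y : E3 | M / 40 < ‖y‖ ∧ ‖y‖ < 3 * M / 4}, hΩo⟩ rfl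
  -- the Kerr–Schild zone datum
  obtain ⟨DK, hDKvac, hDK⟩ := exists_ksZoneData hM (7 * M / 10)
    (fun U Φ N f ν ↦ hInd (7 * M / 10) U Φ N f ν (hRic _))
  -- the leaf zone
  obtain ⟨φ, ψ, Dl, -, hψφ, hφψ, hφs, hψs, hDlvac, hDlnear, hDlfar, hDlh, hDlk⟩ :=
    exists_leafZoneData hM hM0 hr₁ hr₁4 (fun U Φ N f ν ↦ hInd r₁ U Φ N f ν (hRic _)) hsp hN₀ hν
      hQs hSs hQm hSm hSQ hQS hQid hSid hQfar
  -- the glued datum, with its core export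
  obtain ⟨D, hDvac, hDL, hcore⟩ := exists_zonesData_core hM0 hρ₃M hr₁a hr₁b D₀ hvac₀ hexact₀ rfl Db hDbvac hDbin
    hDbout DK hDKvac hDK Dl hDlvac hDlnear
  refine ⟨D, hDvac, ⟨7 * M, by positivity, fun y hy ↦ ?_⟩, hcore, M, 0, r₁, hM, Negative.bentHeight M 0,
    fun y ↦ (φ y : E3), Negative.graph M 0 r₁, fun y ↦ N₀ y, fun y ↦ lt_norm_of_mem_slice_zero hr₁.le (φ y).2,
    h0, ?_, ?_, rfl, ?_, ?_, ?_, fun _ ↦ rfl, hsp, hν, ?_, ?_⟩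
  · -- the far clause: isotropic Schwarzschild beyond `7M`
    have hyL : y ∈ Kerr.slice 0 r₁ := mem_slice_zero_of_lt hr₁.le (by linarith)
    obtain hfar := hDlfar ⟨y, hyL⟩ hy
    refine ⟨fun v w ↦ ?_, ContinuousLinearMap.ext fun v ↦ ContinuousLinearMap.ext fun w ↦ ?_⟩
    · rw [(hDL y hyL v w).1]; exact (hfar v w).1
    · rw [(hDL y hyL v w).2]; exact (hfar v w).2
  · -- `r₋ = 0 < r₁`
    have h := Negative.rPlus_add_rMinus M 0
    rw [Kerr.rPlus_zero_right hM] at h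
    linarith
  · -- `r₁ < r₊ = 2M`
    rw [Kerr.rPlus_zero_right hM]; exact hr₁b
  · -- compact complement of the end chart: the closed ball of radius `r₁`
    have hrange : Set.range (fun y : Kerr.slice 0 r₁ ↦ (φ y : E3)) = {z : E3 | r₁ < ‖z‖} := by
      ext z
      constructor
      · rintro ⟨y, rfl⟩
        exact lt_norm_of_mem_slice_zero hr₁.le (φ y).2
      · intro hz
        exact ⟨ψ ⟨z, mem_slice_zero_of_lt hr₁.le hz⟩, by
          show ((φ (ψ ⟨z, mem_slice_zero_of_lt hr₁.le hz⟩) : Kerr.slice 0 r₁) : E3) = z; rw [hφψ]⟩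
    have hcompl : (Set.range (fun y : Kerr.slice 0 r₁ ↦ (φ y : E3)))ᶜ = Metric.closedBall (0 : E3) r₁ := by
      rw [hrange]
      ext z
      simp [Metric.mem_closedBall, dist_zero_right, not_lt]
    rw [hcompl]
    exact isCompact_closedBall 0 r₁
  · -- open embedding: a self-homeomorphism of the slice followed by the inclusion
    let H : Kerr.slice 0 r₁ ≃ₜ Kerr.slice 0 r₁ :=
      { toFun := φ, invFun := ψ, left_inv := hψφ, right_inv := hφψ,
        continuous_toFun := hφs.continuous, continuous_invFun := hψs.continuous }
    exact (Kerr.slice 0 r₁).isOpen.isOpenEmbedding_subtypeVal.comp H.isOpenEmbedding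
  · -- smooth
    exact contMDiff_subtype_val.comp hφs
  · -- the pull-back identity for `h`
    intro y
    have hφd : MDifferentiableAt 𝓘(ℝ, E3) 𝓘(ℝ, E3) φ y := hφs.mdifferentiableAt (by simp)
    have hdE : ∀ u : E3, mfderiv 𝓘(ℝ, E3) (𝓡 3) (fun y : Kerr.slice 0 r₁ ↦ (φ y : E3)) y u =
        mfderiv 𝓘(ℝ, E3) 𝓘(ℝ, E3) φ y u := fun u ↦ by
      have h := mfderiv_comp y (OpenSubmanifold.mdifferentiableAt_subtype_val (φ y)) hφd
      rw [OpenSubmanifold.mfderiv_subtype_val] at h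
      exact congrArg (fun L : E3 →L[ℝ] E3 ↦ L u) h
    ext v w
    rw [pullbackBilin_apply, pullbackBilin_apply, hdE v, hdE w, (hDL (φ y : E3) (φ y).2 _ _).1]
    exact hDlh y v w
  · -- the pull-back identity for `k`
    intro _ y
    have hφd : MDifferentiableAt 𝓘(ℝ, E3) 𝓘(ℝ, E3) φ y := hφs.mdifferentiableAt (by simp)
    have hdE : ∀ u : E3, mfderiv 𝓘(ℝ, E3) (𝓡 3) (fun y : Kerr.slice 0 r₁ ↦ (φ y : E3)) y u =
        mfderiv 𝓘(ℝ, E3) 𝓘(ℝ, E3) φ y u := fun u ↦ by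
      have h := mfderiv_comp y (OpenSubmanifold.mdifferentiableAt_subtype_val (φ y)) hφd
      rw [OpenSubmanifold.mfderiv_subtype_val] at h
      exact congrArg (fun L : E3 →L[ℝ] E3 ↦ L u) h
    refine LinearMap.ext fun v ↦ LinearMap.ext fun w ↦ ?_
    have hlhs : (pullbackBilin (I := 𝓡 3) (I' := 𝓘(ℝ, E3)) (fun y : Kerr.slice 0 r₁ ↦ (φ y : E3)) D.k y).toLinearMap₁₂ v w
        = D.k (φ y : E3) (mfderiv 𝓘(ℝ, E3) (𝓡 3) (fun y : Kerr.slice 0 r₁ ↦ (φ y : E3)) y v)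
          (mfderiv 𝓘(ℝ, E3) (𝓡 3) (fun y : Kerr.slice 0 r₁ ↦ (φ y : E3)) y w) := rfl
    rw [hlhs, hdE v, hdE w, (hDL (φ y : E3) (φ y).2 _ _).2]
    exact hDlk y v w

end LocatedPlug

/-- **Stub S5a `stub_locatedPlug` of line `receding-annulus-universal-collar` (crux `stmt-FinalStateConjecture-10052`).**
From PlugData (`D₀` vacuum on `ℝ³`, exactly time-symmetric isotropic Schwarzschild(`M`) beyond `ρ₃ < M/40`) an
ADMISSIBLE datum `D` on `ℝ³` which IS `D₀` on the core ball `{‖y‖ < M/32}` and is Kerr-shielded by a chart ranging in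
`{‖y‖ > M}`: slice clause at the junction radius `r₁ := M` (`stub_sliceClause`) → bridge (`stub_bridgeAnnulus`, fed
with `stub_ricciFlatKS`, `stub_inducedVacuumData`) → `LocatedPlug.assembly_located` → isotropic end
(`stub_isotropicEnd`) → completeness (`isComplete_of_isSoleEnd_holds`, Gordon's criterion) → `admissibleVacuumData`.
[cite: LiMei2020, §2.2] [cite: ONeill1983, Ch. 13] [cite: Christodoulou1999, p. A24] -/
theorem stub_locatedPlug : ∀ [Kerr.Facts] (M ρ₃ : ℝ) (D₀ : InitialDataSet (𝓡 3) E3), 0 < M → 0 < ρ₃ → ρ₃ < M / 40 →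
    (∀ [D₀.metric.HasLeviCivita], D₀.IsVacuumConstraintSolution) →
    (∀ y : E3, ρ₃ < ‖y‖ →
      (∀ v w : E3, D₀.h.inner y v w = Schwarzschild.conformalFactor M y ^ 4 * ⟪v, w⟫_ℝ) ∧ D₀.k y = 0) →
    ∃ D ∈ admissibleVacuumData E3,
      (∀ y : E3, ‖y‖ < M / 32 → D.h.inner y = D₀.h.inner y ∧ D.k y = D₀.k y) ∧ IsKerrShieldedAway M D := by
  intro _ M ρ₃ D₀ hMpos _ hρ₃M hvac₀ hexact₀
  have h34 : 3 * M / 4 < M := by linarith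
  have h2M : M < 2 * M := by linarith
  obtain ⟨hT, hsp, N₀, hN₀, hν⟩ := @stub_sliceClause _ M M hMpos.le hMpos hMpos
  have hRic := fun r₀ ↦ @stub_ricciFlatKS _ M r₀
  have hInd := fun r₀ ↦ @stub_inducedVacuumData _ M r₀
  have hBr := @stub_bridgeAnnulus _ M hMpos hRic hInd hT
  obtain ⟨D, hvac, ⟨R, hR, hfar⟩, hcore, haway⟩ :=
    LocatedPlug.assembly_located hMpos.le hMpos hρ₃M D₀ hvac₀ hexact₀ hRic hInd hBr h34 h2M hsp N₀ hN₀ hν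
  obtain ⟨e, hsole, hDR⟩ := stub_isotropicEnd D M R hMpos.le hR hfar
  have hadm : D ∈ admissibleVacuumData E3 := by
    refine mem_admissibleVacuumData_iff.mpr ⟨?_, e, M, hsole, hDR⟩
    intro hLC
    exact ⟨hvac, isComplete_of_isSoleEnd_holds E3 D e M 1 2 2 1 zero_le_one hDR hsole⟩
  exact ⟨D, hadm, hcore, haway⟩

end Summit.FinalStateConjecture.FinalStateConjecture.Theorems.SwallowTheDatum.ParametricKerrBurial

end
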